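import Literature.Topology.FourManifolds.Diffeotopy
import Literature.Topology.FourManifolds.ChartTransport
import HarnessLib

/-!
# Conjugation of diffeotopies; transport of compactly supported diffeotopies along charts

Topic `Literature/Topology/FourManifolds`. Toolkit for the reduction of Cerf's Théorème 1
(`π₀ Diff⁺ S³ = 0`, named fact `Literature.Topology.FourManifolds.cerf_pi0Diff_sphere_three` of `RadialExtension.lean`) to the
relative form `π₀(Diff(D³; S²)) = 0` (Cerf 1968, Ch. I §2, (2); Appendice, Proposition 4), carried
out in `CerfPropositionFour.lean`. Everything here is PROVED and stated for a general manifold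
`N` (resp. a manifold `M` modelled on a real normed space `E`).

## Contents

* `Literature.Topology.FourManifolds.Diffeotopy.pushforward`: conjugating a diffeotopy `F_t` of `N` (`Diffeotopy.lean`: a
  level-preserving diffeomorphism of `ℝ × N`) by a diffeomorphism `h` gives the diffeotopy
  `h ∘ F_t ∘ h⁻¹`; hence the identity component of `Diff N` is normal
  (`Diffeomorph.IsDiffeotopicToId.conj`) and the relation "diffeotopic" is compatible with
  composition on both sides (`Diffeomorph.IsDiffeotopic.trans_right/left`,
  `Diffeomorph.isDiffeotopic_trans_of_isDiffeotopicToId`, …).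
* `Literature.Topology.FourManifolds.Diffeotopy.chartTransport`: the **parametric form of `ChartTransport.lean`**. Let
  `φ : M ⊇ U → E` be a smooth chart of `M` onto the whole model space (smooth with smooth
  inverse) and `D` a diffeotopy of `E` all of whose stages are the identity off a fixed ball
  `B̄(0, R)`. Then the stagewise transports `φ⁻¹ ∘ D_t ∘ φ` extended by the identity
  (`Literature.chartTransport φ (D_t)`) form a diffeotopy of `M`. This is the extension by the identity
  of a compactly supported diffeotopy of an open subset (Hirsch, *Differential Topology* (1976),
  Ch. 8 §1, Thms. 1.3–1.4 and the proof of Thm. 3.2), in the flow-free chart form of the tree.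
  Consequently (`Literature.Topology.FourManifolds.isDiffeotopicToId_chartTransportDiffeomorph`), if a compactly supported
  diffeomorphism `s` of `E` is the time-one stage of such a diffeotopy, its transport
  `Literature.chartTransportDiffeomorph φ s` (the diffeomorphism of `exists_diffeomorph_chartTransport`,
  here given a name) is diffeotopic to the identity of `M`.
* `Literature.Topology.FourManifolds.CompactDiffeotopyTrivial E`: the PREDICATE on the model space
  `E` "every compactly supported diffeomorphism of `E` is compactly diffeotopic to the identity"
  (`π₀` of the group of compactly supported diffeomorphisms of `E` is trivial), and its reduction
  `CompactDiffeotopyTrivial.of_unitBall` to diffeomorphisms and diffeotopies supported in the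
  closed unit ball (`UnitBallDiffeotopyTrivial E`; conjugation by homotheties). These are
  hypothesis schemas taken as `(hK : CompactDiffeotopyTrivial (𝔼 n))`, NOT named facts: whether
  they hold depends on `E` (see the docstring of `CompactDiffeotopyTrivial` for the status by
  dimension; `E = ℝ⁶` is a counterexample, `E = ℝ⁴` is open). Proved instances: `E` trivial
  (`compactDiffeotopyTrivial_of_subsingleton`, here) and `E = ℝ`, `ℝ¹`
  (`unitBallDiffeotopyTrivial_real`, `unitBallDiffeotopyTrivial_euclideanSpace_one` of
  `CerfPropositionFour.lean`); for `E = ℝ³` the unit-ball form is Cerf's statement `π₀(𝒦) = 0`,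
  the named fact `cerf_pi0DiffDisc_relBoundary_three` of `CerfPropositionFour.lean`.

## References

* M. W. Hirsch, *Differential Topology*, GTM 33, Springer (1976), Ch. 8 §1 (diffeotopies,
  support, Thms. 1.3–1.4), §3 (proof of Thm. 3.2). [HirschDT1976]
* J. Cerf, *Sur les difféomorphismes de la sphère de dimension trois (Γ₄ = 0)*, LNM 53 (1968),
  Ch. I §§1–2, Appendice §5. [CerfDiffeoSphere1968]
* For the status of `π₀ Diff_c(ℝⁿ)` quoted in the docstring of `CompactDiffeotopyTrivial`:
  S. Smale, *Diffeomorphisms of the 2-sphere*, Proc. AMS 10 (1959), 621–626, Thm. B (`n = 2`);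
  J. Milnor, *On manifolds homeomorphic to the 7-sphere*, Ann. of Math. 64 (1956), Thm. 3, and
  M. Kervaire, J. Milnor, *Groups of homotopy spheres I*, Ann. of Math. 77 (1963), table p. 504
  (`Θ₇ ≅ ℤ/28`, whence `n = 6` fails) [Milnor1956] [KervaireMilnorAnnals1963]; J. Cerf, *La
  stratification naturelle des espaces de fonctions différentiables réelles et le théorème de la
  pseudo-isotopie*, Publ. Math. IHÉS 39 (1970) (`π₀ Diff(Dⁿ rel ∂) ≅ Θₙ₊₁`, `n ≥ 5`).
-/

open scoped Manifold ContDiff Topology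
open Function Set

noncomputable section

namespace Literature.Topology.FourManifolds

/-! ## Smooth maps on products of model spaces -/

/-- A `C^n` map on a product `E × F` of model vector spaces is `C^n` for the product model with
corners `𝓘(ℝ, E).prod 𝓘(ℝ, F)` (the model of `ℝ × N`-type products used by `Diffeotopy`);
Mathlib's `modelWithCornersSelf_prod` / `chartedSpaceSelf_prod`. [folklore] -/
theorem contMDiff_prod_self_of_contDiff {E F G : Type*} [NormedAddCommGroup E] [NormedSpace ℝ E]
    [NormedAddCommGroup F] [NormedSpace ℝ F] [NormedAddCommGroup G] [NormedSpace ℝ G]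
    {m : WithTop ℕ∞} {g : E × F → G} (hg : ContDiff ℝ m g) :
    ContMDiff (𝓘(ℝ, E).prod 𝓘(ℝ, F)) 𝓘(ℝ, G) m g := by
  rw [← modelWithCornersSelf_prod, chartedSpaceSelf_prod]
  exact hg.contMDiff

/-! ## Conjugation of diffeotopies -/

namespace Diffeotopy

variable {EN HN : Type*} [NormedAddCommGroup EN] [NormedSpace ℝ EN] [TopologicalSpace HN]
  {J : ModelWithCorners ℝ EN HN} {N : Type*} [TopologicalSpace N] [ChartedSpace HN N]

/-- **Push-forward (conjugate) of a diffeotopy by a diffeomorphism**: the diffeotopy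
`t ↦ h ∘ F_t ∘ h⁻¹` (conjugate the track by `id × h`). Hirsch (1976), Ch. 8 §1. (The tree's
`Literature.Topology.FourManifolds.Diffeotopy.conj` of `SurgeredMappingTorus.lean` is the opposite conjugate `h⁻¹ ∘ F_t ∘ h`;
the present file does not import that one.) [folklore] -/
def pushforward (D : Diffeotopy J N) (h : N ≃ₘ⟮J, J⟯ N) : Diffeotopy J N :=
  Diffeotopy.mk' J (fun t x => h (D.toFun t (h.symm x))) (fun t y => h (D.invFun t (h.symm y)))
    (by
      have h1 : ContMDiff (𝓘(ℝ, ℝ).prod J) (𝓘(ℝ, ℝ).prod J) ∞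
          (fun p : ℝ × N => (p.1, h.symm p.2)) :=
        contMDiff_fst.prodMk (h.symm.contMDiff.comp contMDiff_snd)
      exact h.contMDiff.comp (D.contMDiff_uncurry_toFun.comp h1))
    (by
      have h1 : ContMDiff (𝓘(ℝ, ℝ).prod J) (𝓘(ℝ, ℝ).prod J) ∞
          (fun p : ℝ × N => (p.1, h.symm p.2)) :=
        contMDiff_fst.prodMk (h.symm.contMDiff.comp contMDiff_snd)
      exact h.contMDiff.comp (D.contMDiff_uncurry_invFun.comp h1))
    (fun t x => by simp) (fun t y => by simp) (by funext x; simp)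

/-- Stages of the pushed-forward diffeotopy. [folklore] -/
@[simp]
theorem pushforward_toFun (D : Diffeotopy J N) (h : N ≃ₘ⟮J, J⟯ N) (t : ℝ) (x : N) :
    (D.pushforward h).toFun t x = h (D.toFun t (h.symm x)) :=
  rfl

/-- Inverse stages of the pushed-forward diffeotopy. [folklore] -/
@[simp]
theorem pushforward_invFun (D : Diffeotopy J N) (h : N ≃ₘ⟮J, J⟯ N) (t : ℝ) (y : N) :
    (D.pushforward h).invFun t y = h (D.invFun t (h.symm y)) :=
  rfl

/-- The time-`t` stage of the pushed-forward diffeotopy is the conjugated stage. [folklore] -/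
theorem pushforward_stage (D : Diffeotopy J N) (h : N ≃ₘ⟮J, J⟯ N) (t : ℝ) :
    (D.pushforward h).stage t = h.symm.trans ((D.stage t).trans h) :=
  Diffeomorph.ext fun _ => rfl

end Diffeotopy

namespace Diffeomorph

variable {EN HN : Type*} [NormedAddCommGroup EN] [NormedSpace ℝ EN] [TopologicalSpace HN]
  {J : ModelWithCorners ℝ EN HN} {N : Type*} [TopologicalSpace N] [ChartedSpace HN N]

/-- **The identity component of `Diff N` is normal**: conjugates of diffeomorphisms diffeotopic to
the identity are diffeotopic to the identity. [folklore] -/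
theorem IsDiffeotopicToId.conj {φ : N ≃ₘ⟮J, J⟯ N} (hφ : IsDiffeotopicToId φ) (h : N ≃ₘ⟮J, J⟯ N) :
    IsDiffeotopicToId (h.symm.trans (φ.trans h)) := by
  obtain ⟨D, rfl⟩ := hφ
  exact ⟨D.pushforward h, D.pushforward_stage h 1⟩

/-- Conjugation in the other order. [folklore] -/
theorem IsDiffeotopicToId.conj' {φ : N ≃ₘ⟮J, J⟯ N} (hφ : IsDiffeotopicToId φ) (h : N ≃ₘ⟮J, J⟯ N) :
    IsDiffeotopicToId (h.trans (φ.trans h.symm)) := by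
  have h1 : h.trans (φ.trans h.symm) = h.symm.symm.trans (φ.trans h.symm) :=
    Diffeomorph.ext fun _ => rfl
  rw [h1]
  exact hφ.conj h.symm

/-- Diffeotopy classes are stable under composition on the right with a fixed diffeomorphism.
[folklore] -/
theorem IsDiffeotopic.trans_right {φ ψ : N ≃ₘ⟮J, J⟯ N} (hφψ : IsDiffeotopic φ ψ)
    (h : N ≃ₘ⟮J, J⟯ N) : IsDiffeotopic (φ.trans h) (ψ.trans h) := by
  rw [isDiffeotopic_iff] at hφψ ⊢
  have h1 : (φ.trans h).symm.trans (ψ.trans h) = h.symm.trans ((φ.symm.trans ψ).trans h) :=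
    Diffeomorph.ext fun _ => rfl
  rw [h1]
  exact hφψ.conj h

/-- Diffeotopy classes are stable under composition on the left with a fixed diffeomorphism.
[folklore] -/
theorem IsDiffeotopic.trans_left {φ ψ : N ≃ₘ⟮J, J⟯ N} (hφψ : IsDiffeotopic φ ψ)
    (h : N ≃ₘ⟮J, J⟯ N) : IsDiffeotopic (h.trans φ) (h.trans ψ) := by
  rw [isDiffeotopic_iff] at hφψ ⊢
  convert hφψ using 1
  ext x
  simp

/-- `φ` is diffeotopic to `φ ≫ ψ` when `ψ` is diffeotopic to the identity. [folklore] -/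
theorem isDiffeotopic_trans_of_isDiffeotopicToId (φ : N ≃ₘ⟮J, J⟯ N) {ψ : N ≃ₘ⟮J, J⟯ N}
    (hψ : IsDiffeotopicToId ψ) : IsDiffeotopic φ (φ.trans ψ) := by
  rw [isDiffeotopic_iff]
  convert hψ using 1
  ext x
  simp

/-- `φ` is diffeotopic to `θ ≫ φ` when `θ` is diffeotopic to the identity. [folklore] -/
theorem isDiffeotopic_trans_of_isDiffeotopicToId' (φ : N ≃ₘ⟮J, J⟯ N) {θ : N ≃ₘ⟮J, J⟯ N}
    (hθ : IsDiffeotopicToId θ) : IsDiffeotopic φ (θ.trans φ) := by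
  rw [isDiffeotopic_iff]
  exact hθ.conj φ

/-- A diffeomorphism diffeotopic to one that is diffeotopic to the identity is itself diffeotopic
to the identity. [folklore] -/
theorem IsDiffeotopic.isDiffeotopicToId {φ ψ : N ≃ₘ⟮J, J⟯ N} (hφψ : IsDiffeotopic φ ψ)
    (hφ : IsDiffeotopicToId φ) : IsDiffeotopicToId ψ := by
  rw [← isDiffeotopic_refl_iff] at hφ ⊢
  exact hφ.trans hφψ

end Diffeomorph

/-! ## Transport of compactly supported diffeotopies of the model along a chart -/

section Transport

variable {E : Type*} [NormedAddCommGroup E] [NormedSpace ℝ E] {M : Type*} [TopologicalSpace M]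
  [ChartedSpace E M] [T2Space M] [ProperSpace E] {φ : OpenPartialHomeomorph M E}

omit [NormedSpace ℝ E] [ChartedSpace E M] [T2Space M] [ProperSpace E] in
/-- The transport of the identity is the identity. [folklore] -/
theorem chartTransport_id_eq : chartTransport φ (id : E → E) = id := by
  funext x
  by_cases hx : x ∈ φ.source
  · rw [chartTransport_of_mem _ hx, id, φ.left_inv hx]; rfl
  · exact chartTransport_of_not_mem _ hx

/-- **The transport of a compactly supported diffeomorphism of the model along a smooth chart with
full target**, as a named diffeomorphism of `M`: `φ⁻¹ ∘ s ∘ φ` on the chart domain, the identity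
elsewhere (this is the diffeomorphism produced by `exists_diffeomorph_chartTransport`,
`ChartTransport.lean`). [folklore] -/
def chartTransportDiffeomorph (hφ : ContMDiffOn 𝓘(ℝ, E) 𝓘(ℝ, E) ∞ φ φ.source)
    (hφ' : ContMDiff 𝓘(ℝ, E) 𝓘(ℝ, E) ∞ φ.symm) (htarget : φ.target = univ)
    (s : E ≃ₘ⟮𝓘(ℝ, E), 𝓘(ℝ, E)⟯ E) {R : ℝ} (hs : ∀ y, R ≤ ‖y‖ → s y = y) :
    M ≃ₘ⟮𝓘(ℝ, E), 𝓘(ℝ, E)⟯ M where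
  toFun := chartTransport φ s
  invFun := chartTransport φ s.symm
  left_inv := chartTransport_chartTransport htarget s.symm_apply_apply
  right_inv := chartTransport_chartTransport htarget s.apply_symm_apply
  contMDiff_toFun := contMDiff_chartTransport hφ hφ' htarget s.contMDiff hs
  contMDiff_invFun := by
    have hs' : ∀ y, R ≤ ‖y‖ → s.symm y = y := fun y hy ↦ by
      conv_lhs => rw [← hs y hy]
      exact s.symm_apply_apply y
    exact contMDiff_chartTransport hφ hφ' htarget s.symm.contMDiff hs'

/-- The transport diffeomorphism is, as a function, `chartTransport φ s` (definitional).
[folklore] -/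
@[simp]
theorem coe_chartTransportDiffeomorph (hφ : ContMDiffOn 𝓘(ℝ, E) 𝓘(ℝ, E) ∞ φ φ.source)
    (hφ' : ContMDiff 𝓘(ℝ, E) 𝓘(ℝ, E) ∞ φ.symm) (htarget : φ.target = univ)
    (s : E ≃ₘ⟮𝓘(ℝ, E), 𝓘(ℝ, E)⟯ E) {R : ℝ} (hs : ∀ y, R ≤ ‖y‖ → s y = y) :
    ⇑(chartTransportDiffeomorph hφ hφ' htarget s hs) = chartTransport φ s :=
  rfl

/-- The defining relation `H ∘ φ⁻¹ = φ⁻¹ ∘ s` of the transport diffeomorphism. [folklore] -/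
theorem chartTransportDiffeomorph_symm_apply (hφ : ContMDiffOn 𝓘(ℝ, E) 𝓘(ℝ, E) ∞ φ φ.source)
    (hφ' : ContMDiff 𝓘(ℝ, E) 𝓘(ℝ, E) ∞ φ.symm) (htarget : φ.target = univ)
    (s : E ≃ₘ⟮𝓘(ℝ, E), 𝓘(ℝ, E)⟯ E) {R : ℝ} (hs : ∀ y, R ≤ ‖y‖ → s y = y) (y : E) :
    chartTransportDiffeomorph hφ hφ' htarget s hs (φ.symm y) = φ.symm (s y) :=
  chartTransport_symm_apply htarget s y

/-- Off `φ⁻¹(B̄(0, R))` the transport diffeomorphism is the identity. [folklore] -/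
theorem chartTransportDiffeomorph_eq_self (hφ : ContMDiffOn 𝓘(ℝ, E) 𝓘(ℝ, E) ∞ φ φ.source)
    (hφ' : ContMDiff 𝓘(ℝ, E) 𝓘(ℝ, E) ∞ φ.symm) (htarget : φ.target = univ)
    (s : E ≃ₘ⟮𝓘(ℝ, E), 𝓘(ℝ, E)⟯ E) {R : ℝ} (hs : ∀ y, R ≤ ‖y‖ → s y = y) {x : M}
    (hx : x ∉ φ.symm '' Metric.closedBall (0 : E) R) :
    chartTransportDiffeomorph hφ hφ' htarget s hs x = x :=
  chartTransport_eq_self hs hx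

namespace Diffeotopy

omit [ProperSpace E] in
/-- If all stages of a diffeotopy of `E` are the identity off `B̄(0, R)`, so are all inverse
stages. [folklore] -/
theorem invFun_eq_self_of_toFun (D : Diffeotopy 𝓘(ℝ, E) E) {R : ℝ}
    (hD : ∀ t y, R ≤ ‖y‖ → D.toFun t y = y) (t : ℝ) (y : E) (hy : R ≤ ‖y‖) :
    D.invFun t y = y := by
  conv_lhs => rw [← hD t y hy]
  exact D.invFun_toFun t y

/-- **Transport of a compactly supported diffeotopy of the model along a chart with full
target.** Let `φ : M ⊇ U → E` be a smooth chart onto the whole model space (smooth with smooth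
inverse) and `D` a diffeotopy of `E` whose stages are all the identity off a fixed ball
`B̄(0, R)`. Then the stagewise transports `chartTransport φ (D_t)` (`φ⁻¹ ∘ D_t ∘ φ` on `U`, the
identity elsewhere) form a diffeotopy of `M`: near `ℝ × U` the family is a composite of smooth
maps, and near the closed set `ℝ × (M ∖ φ⁻¹(B̄(0, R)))` it is the identity. This is the extension
by the identity of a compactly supported diffeotopy of an open subset, Hirsch (1976), Ch. 8 §1,
Thms. 1.3–1.4 (there via vector fields). [cite: HirschDT1976, Ch. 8 §1, Thm. 1.3] -/
def chartTransport (hφ : ContMDiffOn 𝓘(ℝ, E) 𝓘(ℝ, E) ∞ φ φ.source)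
    (hφ' : ContMDiff 𝓘(ℝ, E) 𝓘(ℝ, E) ∞ φ.symm) (htarget : φ.target = univ)
    (D : Diffeotopy 𝓘(ℝ, E) E) {R : ℝ} (hD : ∀ t y, R ≤ ‖y‖ → D.toFun t y = y) :
    Diffeotopy 𝓘(ℝ, E) M := by
  -- joint smoothness of a stagewise transport, for any jointly smooth family supported in the ball
  have key : ∀ F : ℝ → E → E, ContMDiff (𝓘(ℝ, ℝ).prod 𝓘(ℝ, E)) 𝓘(ℝ, E) ∞ (uncurry F) →
      (∀ t y, R ≤ ‖y‖ → F t y = y) →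
      ContMDiff (𝓘(ℝ, ℝ).prod 𝓘(ℝ, E)) 𝓘(ℝ, E) ∞
        (uncurry fun t x => Literature.Topology.FourManifolds.chartTransport φ (F t) x) := by
    intro F hF hFs p
    obtain ⟨t, x⟩ := p
    by_cases hxs : x ∈ φ.source
    · -- near `ℝ × U` the family is `φ⁻¹ ∘ F_t ∘ φ`
      have hev : (uncurry fun t x => Literature.Topology.FourManifolds.chartTransport φ (F t) x) =ᶠ[𝓝 (t, x)]
          fun q : ℝ × M => φ.symm (F q.1 (φ q.2)) := by
        filter_upwards [prod_mem_nhds Filter.univ_mem (φ.open_source.mem_nhds hxs)] with q hq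
        exact chartTransport_of_mem (F q.1) hq.2
      refine ContMDiffAt.congr_of_eventuallyEq ?_ hev
      have h1 : ContMDiffAt (𝓘(ℝ, ℝ).prod 𝓘(ℝ, E)) (𝓘(ℝ, ℝ).prod 𝓘(ℝ, E)) ∞
          (fun q : ℝ × M => (q.1, φ q.2)) (t, x) :=
        contMDiffAt_fst.prodMk ((hφ.contMDiffAt (φ.open_source.mem_nhds hxs)).comp (t, x)
          contMDiffAt_snd)
      exact hφ'.contMDiffAt.comp (t, x) (hF.contMDiffAt.comp (t, x) h1)
    · -- near `ℝ × (M ∖ φ⁻¹(B̄(0, R)))` the family is the identity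
      have hK : IsClosed (φ.symm '' Metric.closedBall (0 : E) R) :=
        ((isCompact_closedBall (0 : E) R).image_of_continuousOn
          hφ'.continuous.continuousOn).isClosed
      have hxK : x ∉ φ.symm '' Metric.closedBall (0 : E) R := by
        rintro ⟨y, -, rfl⟩
        exact hxs (φ.map_target (by simp [htarget]))
      have hev : (uncurry fun t x => Literature.Topology.FourManifolds.chartTransport φ (F t) x) =ᶠ[𝓝 (t, x)]
          fun q : ℝ × M => q.2 := by
        filter_upwards [prod_mem_nhds Filter.univ_mem (hK.isOpen_compl.mem_nhds hxK)] with q hq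
        exact chartTransport_eq_self (hFs q.1) hq.2
      exact contMDiffAt_snd.congr_of_eventuallyEq hev
  refine Diffeotopy.mk' 𝓘(ℝ, E) (fun t x => Literature.Topology.FourManifolds.chartTransport φ (D.toFun t) x)
    (fun t y => Literature.Topology.FourManifolds.chartTransport φ (D.invFun t) y) (key D.toFun D.contMDiff_uncurry_toFun hD)
    (key D.invFun D.contMDiff_uncurry_invFun (D.invFun_eq_self_of_toFun hD))
    (fun t x => chartTransport_chartTransport htarget (D.invFun_toFun t) x)
    (fun t y => chartTransport_chartTransport htarget (D.toFun_invFun t) y) ?_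
  funext x
  change Literature.Topology.FourManifolds.chartTransport φ (D.toFun 0) x = x
  rw [D.toFun_zero, chartTransport_id_eq, id]

/-- Stages of the transported diffeotopy (definitional). [folklore] -/
@[simp]
theorem chartTransport_toFun (hφ : ContMDiffOn 𝓘(ℝ, E) 𝓘(ℝ, E) ∞ φ φ.source)
    (hφ' : ContMDiff 𝓘(ℝ, E) 𝓘(ℝ, E) ∞ φ.symm) (htarget : φ.target = univ)
    (D : Diffeotopy 𝓘(ℝ, E) E) {R : ℝ} (hD : ∀ t y, R ≤ ‖y‖ → D.toFun t y = y) (t : ℝ) :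
    (D.chartTransport hφ hφ' htarget hD).toFun t = Literature.Topology.FourManifolds.chartTransport φ (D.toFun t) :=
  rfl

/-- The transported diffeotopy is stationary (the identity) off `φ⁻¹(B̄(0, R))`. [folklore] -/
theorem chartTransport_toFun_eq_self (hφ : ContMDiffOn 𝓘(ℝ, E) 𝓘(ℝ, E) ∞ φ φ.source)
    (hφ' : ContMDiff 𝓘(ℝ, E) 𝓘(ℝ, E) ∞ φ.symm) (htarget : φ.target = univ)
    (D : Diffeotopy 𝓘(ℝ, E) E) {R : ℝ} (hD : ∀ t y, R ≤ ‖y‖ → D.toFun t y = y) (t : ℝ) {x : M}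
    (hx : x ∉ φ.symm '' Metric.closedBall (0 : E) R) :
    (D.chartTransport hφ hφ' htarget hD).toFun t x = x :=
  chartTransport_eq_self (hD t) hx

end Diffeotopy

/-- **A transported diffeomorphism is diffeotopic to the identity of `M` as soon as the
transported compactly supported diffeomorphism `s` of the model is the time-one stage of a
compactly supported diffeotopy of the model** (transport the diffeotopy). [folklore] -/
theorem isDiffeotopicToId_chartTransportDiffeomorph
    (hφ : ContMDiffOn 𝓘(ℝ, E) 𝓘(ℝ, E) ∞ φ φ.source)
    (hφ' : ContMDiff 𝓘(ℝ, E) 𝓘(ℝ, E) ∞ φ.symm) (htarget : φ.target = univ)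
    (s : E ≃ₘ⟮𝓘(ℝ, E), 𝓘(ℝ, E)⟯ E) {R : ℝ} (hs : ∀ y, R ≤ ‖y‖ → s y = y)
    (hsD : ∃ D : Diffeotopy 𝓘(ℝ, E) E, D.stage 1 = s ∧ ∃ R', ∀ t y, R' ≤ ‖y‖ → D.toFun t y = y) :
    Diffeomorph.IsDiffeotopicToId (chartTransportDiffeomorph hφ hφ' htarget s hs) := by
  obtain ⟨D, hD1, R', hD⟩ := hsD
  refine ⟨D.chartTransport hφ hφ' htarget hD, Diffeomorph.ext fun x => ?_⟩
  change Literature.Topology.FourManifolds.chartTransport φ (D.toFun 1) x = Literature.Topology.FourManifolds.chartTransport φ s x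
  rw [← Diffeotopy.coe_stage, hD1]

/-- Variant for an arbitrary diffeomorphism `H` of `M` which agrees, as a function, with the
transport `chartTransport φ s`. [folklore] -/
theorem isDiffeotopicToId_of_coe_eq_chartTransport
    (hφ : ContMDiffOn 𝓘(ℝ, E) 𝓘(ℝ, E) ∞ φ φ.source)
    (hφ' : ContMDiff 𝓘(ℝ, E) 𝓘(ℝ, E) ∞ φ.symm) (htarget : φ.target = univ)
    (s : E ≃ₘ⟮𝓘(ℝ, E), 𝓘(ℝ, E)⟯ E)
    (hsD : ∃ D : Diffeotopy 𝓘(ℝ, E) E, D.stage 1 = s ∧ ∃ R', ∀ t y, R' ≤ ‖y‖ → D.toFun t y = y)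
    (H : M ≃ₘ⟮𝓘(ℝ, E), 𝓘(ℝ, E)⟯ M) (hH : ⇑H = chartTransport φ s) :
    Diffeomorph.IsDiffeotopicToId H := by
  obtain ⟨D, hD1, R', hD⟩ := hsD
  refine ⟨D.chartTransport hφ hφ' htarget hD, Diffeomorph.ext fun x => ?_⟩
  change Literature.Topology.FourManifolds.chartTransport φ (D.toFun 1) x = H x
  rw [← Diffeotopy.coe_stage, hD1, hH]

end Transport

/-! ## Triviality of `π₀` of the compactly supported diffeomorphisms of the model -/

section CompactSupport

/-- The PREDICATE on the model space `E` **"every compactly supported diffeomorphism of `E` is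
compactly diffeotopic to the identity"**: every diffeomorphism `s` of `E` which is the identity
off some ball is the time-one stage of a diffeotopy of `E` all of whose stages are the identity
off some (possibly larger) ball — `π₀` of the group of compactly supported diffeomorphisms of `E`
(smooth paths, uniform compact support) is trivial. This is a property of `E`, used as an explicit
hypothesis `(hK : CompactDiffeotopyTrivial (𝔼 n))` (Cerf's `π₀(𝒦ₙ) = 0` in
`CerfPropositionFour.lean`, `CerfTheoremOneProofs.lean`); it is **not** a named fact and has no
`_holds`: its truth depends on `E`. Status for `E = ℝⁿ` (`π₀ Diff(Dⁿ rel ∂Dⁿ) = 0`?): `n = 0`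
trivial (`compactDiffeotopyTrivial_of_subsingleton`); `n = 1` elementary, proved in
`CerfPropositionFour.lean` (`unitBallDiffeotopyTrivial_real`,
`unitBallDiffeotopyTrivial_euclideanSpace_one`, with `CompactDiffeotopyTrivial.of_unitBall`);
`n = 2` true, Smale (1959), Thm. B (`Diff(D² rel ∂)` is contractible); `n = 3` true, Cerf (1968)
(the radius-free form of `π₀(𝒦) = 0`, vendored as the named fact
`cerf_pi0DiffDisc_relBoundary_three` = `UnitBallDiffeotopyTrivial (𝔼 3)`; Hatcher 1983);
`n = 4` OPEN; `n ≥ 5`: `π₀ Diff(Dⁿ rel ∂) ≅ Θₙ₊₁` (Cerf 1970, pseudo-isotopy, with Smale's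
`h`-cobordism theorem), so it holds iff `Θₙ₊₁ = 0` and FAILS e.g. for `n = 6`
(`Θ₇ ≅ ℤ/28`, Kervaire–Milnor 1963; concretely, Milnor's exotic `7`-sphere (1956) is a twisted
sphere `D⁷ ∪_f D⁷`, and `CompactDiffeotopyTrivial (𝔼 6)` would make `f` diffeotopic to the
identity or a reflection by the tree's proved Proposition 4 of Cerf at `i = 0`,
`Diffeomorph.isDiffeotopicToId_or_isDiffeotopic_sphereReflection_of_compactDiffeotopyTrivial`,
whence `D⁷ ∪_f D⁷ ≅ S⁷`). In particular `∀ E, CompactDiffeotopyTrivial E` is false. [folklore] -/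
def CompactDiffeotopyTrivial (E : Type*) [NormedAddCommGroup E] [NormedSpace ℝ E] : Prop :=
  ∀ (s : E ≃ₘ⟮𝓘(ℝ, E), 𝓘(ℝ, E)⟯ E) (R : ℝ), (∀ y, R ≤ ‖y‖ → s y = y) →
    ∃ D : Diffeotopy 𝓘(ℝ, E) E, D.stage 1 = s ∧ ∃ R', ∀ t y, R' ≤ ‖y‖ → D.toFun t y = y

/-- The same PREDICATE on `E` for diffeomorphisms and diffeotopies **supported in the closed unit
ball** (for `E = ℝⁿ`: `π₀` of Cerf's group `𝒦` of diffeomorphisms of `Dⁿ` infinitely tangent to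
the identity along `Sⁿ⁻¹`, extended by the identity, is trivial). A property of `E`, taken as a
hypothesis `(hK : UnitBallDiffeotopyTrivial (𝔼 n))`, not a named fact (status by dimension as for
`CompactDiffeotopyTrivial`, which it implies, `CompactDiffeotopyTrivial.of_unitBall`; the instance
`E = 𝔼 3` is the named fact `cerf_pi0DiffDisc_relBoundary_three` of `CerfPropositionFour.lean`,
the instances `E = ℝ`, `𝔼 1` are proved there, the instance `E` trivial below). [folklore] -/
def UnitBallDiffeotopyTrivial (E : Type*) [NormedAddCommGroup E] [NormedSpace ℝ E] : Prop :=
  ∀ s : E ≃ₘ⟮𝓘(ℝ, E), 𝓘(ℝ, E)⟯ E, (∀ y, 1 ≤ ‖y‖ → s y = y) →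
    ∃ D : Diffeotopy 𝓘(ℝ, E) E, D.stage 1 = s ∧ ∀ t y, 1 ≤ ‖y‖ → D.toFun t y = y

variable {E : Type*} [NormedAddCommGroup E] [NormedSpace ℝ E]

/-- **The zero-dimensional instance**: over a trivial model space (`E = 0`, e.g. `ℝ⁰`) every
diffeomorphism is the identity, which is the time-one stage of the constant diffeotopy.
[folklore] -/
theorem unitBallDiffeotopyTrivial_of_subsingleton [Subsingleton E] :
    UnitBallDiffeotopyTrivial E := fun _ _ =>
  ⟨Diffeotopy.refl 𝓘(ℝ, E) E, Diffeomorph.ext fun _ => Subsingleton.elim _ _,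
    fun _ _ _ => Subsingleton.elim _ _⟩

/-- The homothety `y ↦ c • y` (`c ≠ 0`) as a diffeomorphism of `E`. [folklore] -/
def homothetyDiffeomorph (c : ℝ) (hc : c ≠ 0) : E ≃ₘ⟮𝓘(ℝ, E), 𝓘(ℝ, E)⟯ E :=
  (ContinuousLinearEquiv.smulLeft (Units.mk0 c hc) : E ≃L[ℝ] E).toDiffeomorph

/-- The homothety diffeomorphism acts as `y ↦ c • y` (definitional). [folklore] -/
@[simp]
theorem homothetyDiffeomorph_apply (c : ℝ) (hc : c ≠ 0) (y : E) :
    homothetyDiffeomorph c hc y = c • y :=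
  rfl

/-- The inverse homothety acts as `y ↦ c⁻¹ • y`. [folklore] -/
@[simp]
theorem homothetyDiffeomorph_symm_apply (c : ℝ) (hc : c ≠ 0) (y : E) :
    (homothetyDiffeomorph c hc).symm y = c⁻¹ • y := by
  have h1 : homothetyDiffeomorph c hc ((homothetyDiffeomorph c hc).symm y) = y :=
    Diffeomorph.apply_symm_apply _ y
  have h2 : homothetyDiffeomorph c hc (c⁻¹ • y) = y := by
    rw [homothetyDiffeomorph_apply, smul_inv_smul₀ hc]
  exact (homothetyDiffeomorph c hc).injective (h1.trans h2.symm)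

/-- **Unit-ball form ⇒ radius-free form**: conjugating by the homothety `y ↦ R • y` carries
diffeomorphisms and diffeotopies supported in `B̄(0, 1)` to ones supported in `B̄(0, R)`.
[folklore] -/
theorem CompactDiffeotopyTrivial.of_unitBall (h : UnitBallDiffeotopyTrivial E) :
    CompactDiffeotopyTrivial E := by
  intro s R hs
  -- enlarge the radius to a positive one
  set R₁ : ℝ := max R 1 with hR₁
  have hR₁0 : 0 < R₁ := lt_of_lt_of_le one_pos (le_max_right _ _)
  have hs₁ : ∀ y, R₁ ≤ ‖y‖ → s y = y := fun y hy ↦ hs y ((le_max_left _ _).trans hy)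
  -- `s' := δ⁻¹ ∘ s ∘ δ`, `δ = R₁ •`, is supported in the unit ball
  set δ := homothetyDiffeomorph (E := E) R₁ hR₁0.ne' with hδ
  set s' := δ.trans (s.trans δ.symm) with hs'
  have hs'₁ : ∀ y, 1 ≤ ‖y‖ → s' y = y := by
    intro y hy
    have hy' : R₁ ≤ ‖R₁ • y‖ := by
      rw [norm_smul, Real.norm_of_nonneg hR₁0.le]
      nlinarith
    simp only [hs', Diffeomorph.coe_trans, comp_apply, hδ, homothetyDiffeomorph_apply]
    rw [hs₁ _ hy', homothetyDiffeomorph_symm_apply, inv_smul_smul₀ hR₁0.ne']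
  obtain ⟨D', hD'1, hD'⟩ := h s' hs'₁
  refine ⟨D'.pushforward δ, ?_, R₁, fun t y hy ↦ ?_⟩
  · rw [Diffeotopy.pushforward_stage, hD'1, hs']
    ext y
    simp
  · have hy' : 1 ≤ ‖R₁⁻¹ • y‖ := by
      rw [norm_smul, norm_inv, Real.norm_of_nonneg hR₁0.le]
      rw [le_inv_mul_iff₀ hR₁0]
      simpa using hy
    simp only [Diffeotopy.pushforward_toFun, hδ, homothetyDiffeomorph_apply,
      homothetyDiffeomorph_symm_apply]
    rw [hD' t _ hy', smul_inv_smul₀ hR₁0.ne']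

/-- **The zero-dimensional instance** of `CompactDiffeotopyTrivial` (trivial model space).
[folklore] -/
theorem compactDiffeotopyTrivial_of_subsingleton [Subsingleton E] : CompactDiffeotopyTrivial E :=
  CompactDiffeotopyTrivial.of_unitBall unitBallDiffeotopyTrivial_of_subsingleton

end CompactSupport

end Literature.Topology.FourManifolds

end
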